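import Summits.CriticalPhenomena.PercolationContinuityZ3.Theorems.Transplant.FKConnectivityAllQApexHubRestTwoPrep
import Summits.CriticalPhenomena.PercolationContinuityZ3.Theorems.Transplant.FKConnectivityAllQApexHubRestTwoInsens
import Summits.CriticalPhenomena.PercolationContinuityZ3.Theorems.Transplant.FKConnectivityAllQApexHubRestTwoAlg
import HarnessLib

/-!
# Connectivity correlation inequalities for `φ_{w,q}` — the hub inequality at `(x; t; z)` for an apex `x` and TWO terminals `t, z` in the
# rest: REDUCTION to three hub inequalities and three edge–connection monotonicities of the rest, EVERY `q > 0`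

Support file (`--supports stmt-CriticalPhenomena-4575`), census seat `prim-bschramm-census` (gen 23) of the post-continuity programme;
builds on p205010 (kernel theorem, internal audit signed; external expert review pending).  No definitions, no named facts, no sorries;
standard axioms.  Assembles `…ApexHubRestTwoPrep.lean` (reachability of two rest vertices across an apex; tilt = contraction),
`…ApexHubRestTwoInsens.lean` (the doubly-attached cylinder's events are `uv`-insensitive) and the certificate `apex_rest_two_alg`
(`…ApexHubRestTwoAlg.lean`).

SETTING: `x` an apex over `(u, v)` (live pairs at `x` ⊆ `{ux, xv}`), `t, z ≠ x`, rest arbitrary; `w° = w[ux, xv ↦ 0]` (apex deleted) and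
`w°⁺ = w°[uv ↦ 1]` (moreover `u, v` merged).  THEOREM **`hubUnder_apex_rest_two`**: the hub inequality `φ_{w,q}(x↔t)·φ_{w,q}(z↔t) ≤ φ_{w,q}(x↔t↔z)`
at `(x; t; z)` follows, for EVERY `q > 0`, from the hub inequalities of `φ_{w°,q}` at `(u;t;z)` and `(v;t;z)`, the hub inequality of `φ_{w°⁺,q}` at
`(u;t;z)`, and the three monotonicities `φ_{w°,q}(y ↔ t) ≤ φ_{w°⁺,q}(y ↔ t)` for `y = z, u, v` (raising the parameter of the pair `uv` to `1` does
not lower these connection probabilities — edge–connection positive dependence of the rest, a theorem for `q ≥ 1` and e.g. on series–parallel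
supports between the terminals of the structure, conjectural in general for `q < 1`).  With `hubUnder_apex_rest_o/_a/_b` this completes the
reductions of all hub placements with one apex terminal and the hub off the apex; census seat gen 23 showed (exact LP) that here, unlike the
one-rest-terminal placements, NO certificate linear in the rest's slacks exists at `q < 1` — the monotonicity hypotheses enter through a product.
[cite: AyyerLinussonRavichandran2025, §7 eq. (13)–(15), Conj. 7.1 (p. 22)] [cite: Grimmett2006, Thm. (3.1)(a) (p. 37); §1.4 eq. (1.20) (p. 15); §3.9 (p. 63)]
-/

noncomputable section

namespace Summit.CriticalPhenomena.PercolationContinuityZ3.Theorems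

namespace FK

open MeasureTheory Set Literature.Probability.LatticeModels Literature.Probability.Percolation
open Literature.Probability.Percolation.DecisionTree (ind ind_of_mem ind_of_not_mem ind_nonneg)
open Literature.Probability.Percolation.TwoAvoidanceSets (ind_mul_ind)
open scoped Classical symmDiff

variable {V : Type*} [Fintype V]

/-- `μ(A) ≤ μ'(A)` for two random-cluster measures gives `S_w(A)·Z_{w'} ≤ Z_w·S_{w'}(A)`. [cite: Grimmett2006, §1.4 eq. (1.20) (p. 15)] -/
theorem mass_cross_le_of_real_le (w w' : Sym2 V → unitInterval) {q : ℝ} (hq : 0 < q) (A : Set (BondConfig V))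
    (h : (rcMeasureW w q ∅).real A ≤ (rcMeasureW w' q ∅).real A) :
    (∑ ω : BondConfig V, rcWeightW w q ∅ ω * ind A ω) * rcPartitionFunctionW w' q ∅ ≤
      rcPartitionFunctionW w q ∅ * ∑ ω : BondConfig V, rcWeightW w' q ∅ ω * ind A ω := by
  rw [rcMeasureW_real_eq_sum_div w hq ∅ A, rcMeasureW_real_eq_sum_div w' hq ∅ A,
    div_le_div_iff₀ (rcPartitionFunctionW_pos w hq (∅ : Set V)) (rcPartitionFunctionW_pos w' hq (∅ : Set V))] at h
  linarith

/-- **Reduction `(x; t; z) ← {(u;t;z), (v;t;z)} in the rest, `(u;t;z)` in the `uv`-contracted rest, and three `uv`-monotonicities`** — see the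
module docstring. [cite: AyyerLinussonRavichandran2025, §7 eq. (13)–(14) (p. 22)] [cite: Grimmett2006, §3.9 (p. 63); Thm. (3.8)] -/
theorem hubUnder_apex_rest_two (w : Sym2 V → unitInterval) {q : ℝ} (hq : 0 < q) {u v x t z : V} (hxu : x ≠ u) (hxv : x ≠ v)
    (huv : u ≠ v) (htx : t ≠ x) (hzx : z ≠ x) (hw : ∀ e : Sym2 V, x ∈ e → ((w e : unitInterval) : ℝ) ≠ 0 → u ∈ e ∨ v ∈ e)
    (hHu : HubUnder (rcMeasureW (Function.update (Function.update w s(u, x) 0) s(x, v) 0) q ∅) u t z)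
    (hHv : HubUnder (rcMeasureW (Function.update (Function.update w s(u, x) 0) s(x, v) 0) q ∅) v t z)
    (hHc : HubUnder (rcMeasureW (Function.update (Function.update (Function.update w s(u, x) 0) s(x, v) 0) s(u, v) 1) q ∅) u t z)
    (hCMz : (rcMeasureW (Function.update (Function.update w s(u, x) 0) s(x, v) 0) q ∅).real (openConn z t) ≤
      (rcMeasureW (Function.update (Function.update (Function.update w s(u, x) 0) s(x, v) 0) s(u, v) 1) q ∅).real (openConn z t))
    (hCMu : (rcMeasureW (Function.update (Function.update w s(u, x) 0) s(x, v) 0) q ∅).real (openConn u t) ≤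
      (rcMeasureW (Function.update (Function.update (Function.update w s(u, x) 0) s(x, v) 0) s(u, v) 1) q ∅).real (openConn u t))
    (hCMv : (rcMeasureW (Function.update (Function.update w s(u, x) 0) s(x, v) 0) q ∅).real (openConn v t) ≤
      (rcMeasureW (Function.update (Function.update (Function.update w s(u, x) 0) s(x, v) 0) s(u, v) 1) q ∅).real (openConn v t)) :
    HubUnder (rcMeasureW w q ∅) x t z := by
  have hq0 : q ≠ 0 := hq.ne'
  set K : Set (BondConfig V) := {ω : BondConfig V | ω \ {s(u, x), s(x, v)} ∈ (openConn u v : Set (BondConfig V))} with hK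
  set Tu : Set (BondConfig V) := {ω : BondConfig V | ω \ {s(u, x), s(x, v)} ∈ (openConn u t : Set (BondConfig V))} with hTu
  set Tv : Set (BondConfig V) := {ω : BondConfig V | ω \ {s(u, x), s(x, v)} ∈ (openConn v t : Set (BondConfig V))} with hTv
  set Zt : Set (BondConfig V) := {ω : BondConfig V | ω \ {s(u, x), s(x, v)} ∈ (openConn z t : Set (BondConfig V))} with hZt
  set Zu : Set (BondConfig V) := {ω : BondConfig V | ω \ {s(u, x), s(x, v)} ∈ (openConn z u : Set (BondConfig V))} with hZu
  set Zv : Set (BondConfig V) := {ω : BondConfig V | ω \ {s(u, x), s(x, v)} ∈ (openConn z v : Set (BondConfig V))} with hZv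
  have hTua : ∀ ω : BondConfig V, ω ∆ {s(u, x)} ∈ Tu ↔ ω ∈ Tu := diffApex_insens u v x _ (Or.inl rfl)
  have hTub : ∀ ω : BondConfig V, ω ∆ {s(x, v)} ∈ Tu ↔ ω ∈ Tu := diffApex_insens u v x _ (Or.inr rfl)
  have hTva : ∀ ω : BondConfig V, ω ∆ {s(u, x)} ∈ Tv ↔ ω ∈ Tv := diffApex_insens u v x _ (Or.inl rfl)
  have hTvb : ∀ ω : BondConfig V, ω ∆ {s(x, v)} ∈ Tv ↔ ω ∈ Tv := diffApex_insens u v x _ (Or.inr rfl)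
  have hZta : ∀ ω : BondConfig V, ω ∆ {s(u, x)} ∈ Zt ↔ ω ∈ Zt := diffApex_insens u v x _ (Or.inl rfl)
  have hZtb : ∀ ω : BondConfig V, ω ∆ {s(x, v)} ∈ Zt ↔ ω ∈ Zt := diffApex_insens u v x _ (Or.inr rfl)
  have hZua : ∀ ω : BondConfig V, ω ∆ {s(u, x)} ∈ Zu ↔ ω ∈ Zu := diffApex_insens u v x _ (Or.inl rfl)
  have hZub : ∀ ω : BondConfig V, ω ∆ {s(x, v)} ∈ Zu ↔ ω ∈ Zu := diffApex_insens u v x _ (Or.inr rfl)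
  have hZva : ∀ ω : BondConfig V, ω ∆ {s(u, x)} ∈ Zv ↔ ω ∈ Zv := diffApex_insens u v x _ (Or.inl rfl)
  have hZvb : ∀ ω : BondConfig V, ω ∆ {s(x, v)} ∈ Zv ↔ ω ∈ Zv := diffApex_insens u v x _ (Or.inr rfl)
  have hapex := fun ω (hω : rcWeightW w q ∅ ω ≠ 0) => apex_of_rcWeightW_ne_zero w q hxu hxv hw hω
  have hKiff : ∀ ω : BondConfig V, ω ∈ K ↔ (openGraph (ω \ {s(u, x), s(x, v)})).Reachable u v := fun ω => by
    rw [hK, Set.mem_setOf_eq, mem_openConn_iff']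
  have hTuiff : ∀ ω : BondConfig V, ω ∈ Tu ↔ (openGraph (ω \ {s(u, x), s(x, v)})).Reachable u t := fun ω => by
    rw [hTu, Set.mem_setOf_eq, mem_openConn_iff']
  have hTviff : ∀ ω : BondConfig V, ω ∈ Tv ↔ (openGraph (ω \ {s(u, x), s(x, v)})).Reachable v t := fun ω => by
    rw [hTv, Set.mem_setOf_eq, mem_openConn_iff']
  have hZtiff : ∀ ω : BondConfig V, ω ∈ Zt ↔ (openGraph (ω \ {s(u, x), s(x, v)})).Reachable z t := fun ω => by
    rw [hZt, Set.mem_setOf_eq, mem_openConn_iff']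
  have hZuiff : ∀ ω : BondConfig V, ω ∈ Zu ↔ (openGraph (ω \ {s(u, x), s(x, v)})).Reachable z u := fun ω => by
    rw [hZu, Set.mem_setOf_eq, mem_openConn_iff']
  have hZviff : ∀ ω : BondConfig V, ω ∈ Zv ↔ (openGraph (ω \ {s(u, x), s(x, v)})).Reachable z v := fun ω => by
    rw [hZv, Set.mem_setOf_eq, mem_openConn_iff']
  have hAiff : ∀ ω, rcWeightW w q ∅ ω ≠ 0 →
      (ω ∈ (openConn x t : Set (BondConfig V)) ↔ (s(u, x) ∈ ω ∧ ω ∈ Tu) ∨ (s(x, v) ∈ ω ∧ ω ∈ Tv)) := fun ω hω => by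
    rw [openConn_comm, mem_openConn_apex_iff hxv htx.symm (hapex ω hω), hTuiff, hTviff, mem_openConn_iff', mem_openConn_iff']
  have hBiff : ∀ ω, rcWeightW w q ∅ ω ≠ 0 →
      (ω ∈ (openConn z t : Set (BondConfig V)) ↔
        ω ∈ Zt ∨ (s(u, x) ∈ ω ∧ s(x, v) ∈ ω ∧ ((ω ∈ Zu ∧ ω ∈ Tv) ∨ (ω ∈ Zv ∧ ω ∈ Tu)))) := fun ω hω => by
    rw [mem_openConn_iff', reachable_rest_apex_iff hxu hxv hzx htx (hapex ω hω), hZtiff, hZuiff, hZviff, hTuiff, hTviff]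
  -- tables: `{x↔t}` ~ (Tu ∪ Tv, Tu, Tv, ∅); `{z↔t}` ~ (C, Zt, Zt, Zt), C = Zt ∪ (Zu ∩ Tv ∪ Zv ∩ Tu); both ~ ((Tu ∪ Tv) ∩ C, Tu ∩ Zt, Tv ∩ Zt, ∅)
  have hCa : ∀ ω : BondConfig V, ω ∆ {s(u, x)} ∈ Zt ∪ (Zu ∩ Tv ∪ Zv ∩ Tu) ↔ ω ∈ Zt ∪ (Zu ∩ Tv ∪ Zv ∩ Tu) :=
    union_insens hZta (union_insens (inter_insens hZua hTva) (inter_insens hZva hTua))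
  have hCb : ∀ ω : BondConfig V, ω ∆ {s(x, v)} ∈ Zt ∪ (Zu ∩ Tv ∪ Zv ∩ Tu) ↔ ω ∈ Zt ∪ (Zu ∩ Tv ∪ Zv ∩ Tu) :=
    union_insens hZtb (union_insens (inter_insens hZub hTvb) (inter_insens hZvb hTub))
  have hA := apex_mass_table w hq0 hxu hxv huv hw (openConn x t) (Tu ∪ Tv) Tu Tv ∅
    (fun ω hω ha hb => by
      rw [hAiff ω hω, Set.mem_union]
      exact ⟨fun h => h.elim (fun h' => Or.inl h'.2) fun h' => Or.inr h'.2, fun h => h.elim (fun h' => Or.inl ⟨ha, h'⟩) fun h' => Or.inr ⟨hb, h'⟩⟩)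
    (fun ω hω hb ha => by
      rw [hAiff ω hω]
      exact ⟨fun h => h.elim (fun h' => h'.2) fun h' => absurd h'.1 hb, fun h => Or.inl ⟨ha, h⟩⟩)
    (fun ω hω ha hb => by
      rw [hAiff ω hω]
      exact ⟨fun h => h.elim (fun h' => absurd h'.1 ha) fun h' => h'.2, fun h => Or.inr ⟨hb, h⟩⟩)
    (fun ω hω ha hb => by
      rw [hAiff ω hω]
      exact ⟨fun h => h.elim (fun h' => absurd h'.1 ha) fun h' => absurd h'.1 hb, fun h => absurd h (Set.notMem_empty ω)⟩)
    (union_insens hTua hTva) (union_insens hTub hTvb) hTua hTvb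
  have hB := apex_mass_table w hq0 hxu hxv huv hw (openConn z t) (Zt ∪ (Zu ∩ Tv ∪ Zv ∩ Tu)) Zt Zt Zt
    (fun ω hω ha hb => by
      rw [hBiff ω hω, Set.mem_union, Set.mem_union, Set.mem_inter_iff, Set.mem_inter_iff]
      exact ⟨fun h => h.elim Or.inl fun h' => Or.inr h'.2.2, fun h => h.elim Or.inl fun h' => Or.inr ⟨ha, hb, h'⟩⟩)
    (fun ω hω hb _ => by
      rw [hBiff ω hω]
      exact ⟨fun h => h.elim id fun h' => absurd h'.2.1 hb, Or.inl⟩)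
    (fun ω hω ha _ => by
      rw [hBiff ω hω]
      exact ⟨fun h => h.elim id fun h' => absurd h'.1 ha, Or.inl⟩)
    (fun ω hω ha _ => by
      rw [hBiff ω hω]
      exact ⟨fun h => h.elim id fun h' => absurd h'.1 ha, Or.inl⟩)
    hCa hCb hZta hZtb
  have hAB := apex_mass_table w hq0 hxu hxv huv hw (openConn x t ∩ openConn z t) ((Tu ∪ Tv) ∩ (Zt ∪ (Zu ∩ Tv ∪ Zv ∩ Tu)))
    (Tu ∩ Zt) (Tv ∩ Zt) ∅
    (fun ω hω ha hb => by
      rw [Set.mem_inter_iff, hAiff ω hω, hBiff ω hω, Set.mem_inter_iff, Set.mem_union, Set.mem_union, Set.mem_union,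
        Set.mem_inter_iff, Set.mem_inter_iff]
      constructor
      · rintro ⟨h1, h2⟩
        exact ⟨h1.elim (fun h' => Or.inl h'.2) fun h' => Or.inr h'.2, h2.elim Or.inl fun h' => Or.inr h'.2.2⟩
      · rintro ⟨h1, h2⟩
        exact ⟨h1.elim (fun h' => Or.inl ⟨ha, h'⟩) fun h' => Or.inr ⟨hb, h'⟩, h2.elim Or.inl fun h' => Or.inr ⟨ha, hb, h'⟩⟩)
    (fun ω hω hb ha => by
      rw [Set.mem_inter_iff, hAiff ω hω, hBiff ω hω, Set.mem_inter_iff]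
      constructor
      · rintro ⟨h1, h2⟩
        exact ⟨h1.elim (fun h' => h'.2) fun h' => absurd h'.1 hb, h2.elim id fun h' => absurd h'.2.1 hb⟩
      · rintro ⟨h1, h2⟩
        exact ⟨Or.inl ⟨ha, h1⟩, Or.inl h2⟩)
    (fun ω hω ha hb => by
      rw [Set.mem_inter_iff, hAiff ω hω, hBiff ω hω, Set.mem_inter_iff]
      constructor
      · rintro ⟨h1, h2⟩
        exact ⟨h1.elim (fun h' => absurd h'.1 ha) fun h' => h'.2, h2.elim id fun h' => absurd h'.1 ha⟩
      · rintro ⟨h1, h2⟩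
        exact ⟨Or.inr ⟨hb, h1⟩, Or.inl h2⟩)
    (fun ω hω ha hb => by
      rw [Set.mem_inter_iff, hAiff ω hω]
      exact ⟨fun h => h.1.elim (fun h' => absurd h'.1 ha) fun h' => absurd h'.1 hb, fun h => absurd h (Set.notMem_empty ω)⟩)
    (inter_insens (union_insens hTua hTva) hCa) (inter_insens (union_insens hTub hTvb) hCb) (inter_insens hTua hZta)
    (inter_insens hTvb hZtb)
  have hZ := apex_mass_table w hq0 hxu hxv huv hw Set.univ Set.univ Set.univ Set.univ Set.univ
    (fun _ _ _ _ => Iff.rfl) (fun _ _ _ _ => Iff.rfl) (fun _ _ _ _ => Iff.rfl) (fun _ _ _ _ => Iff.rfl)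
    (univ_insens _) (univ_insens _) (univ_insens _) (univ_insens _)
  rw [← hK] at hA hB hAB hZ
  -- the rest weights `w0` and the contracted rest weights `w1`
  set w0 := Function.update (Function.update w s(u, x) 0) s(x, v) 0 with hw0
  set w1 := Function.update w0 s(u, v) 1 with hw1
  have hne1 : s(u, v) ≠ s(u, x) := by
    rw [Ne, Sym2.eq_iff]; rintro (⟨-, h⟩ | ⟨h, -⟩); exact hxv h.symm; exact hxu h.symm
  have hne2 : s(u, v) ≠ s(x, v) := by
    rw [Ne, Sym2.eq_iff]; rintro (⟨h, -⟩ | ⟨-, h⟩); exact hxu h.symm; exact hxv h.symm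
  have hd1 : ((w0 s(u, x) : unitInterval) : ℝ) = 0 := apexDead_fst w hxu huv
  have hd2 : ((w0 s(x, v) : unitInterval) : ℝ) = 0 := apexDead_snd w u v x
  have hd1' : ((w1 s(u, x) : unitInterval) : ℝ) = 0 := by rw [hw1, Function.update_of_ne hne1.symm]; exact hd1
  have hd2' : ((w1 s(x, v) : unitInterval) : ℝ) = 0 := by rw [hw1, Function.update_of_ne hne2.symm]; exact hd2
  have h11 : ((w1 s(u, v) : unitInterval) : ℝ) = 1 := by rw [hw1, Function.update_self]; rfl
  -- a.e. facts under `w0` and `w1`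
  have hD0 : ∀ ω, rcWeightW w0 q ∅ ω ≠ 0 → ω \ {s(u, x), s(x, v)} = ω := fun ω hω => diff_apex_eq_self_ae w0 q hd1 hd2 hω
  have hD1 : ∀ ω, rcWeightW w1 q ∅ ω ≠ 0 → ω \ {s(u, x), s(x, v)} = ω := fun ω hω => diff_apex_eq_self_ae w1 q hd1' hd2' hω
  have hUV1 : ∀ ω, rcWeightW w1 q ∅ ω ≠ 0 → (openGraph ω).Reachable u v := fun ω hω =>
    ((openGraph_adj ω u v).2 ⟨mem_of_rcWeightW_ne_zero w1 q h11 hω, huv⟩).reachable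
  -- tilted `w0`-masses of `uv`-insensitive events are `w1`-masses
  have hKc : ∀ G : Set (BondConfig V), ∑ ω : BondConfig V, rcWeightW w0 q ∅ ω * ind (G ∩ Kᶜ) ω =
      ∑ ω : BondConfig V, rcWeightW w0 q ∅ ω * ind (G ∩ (openConn u v : Set (BondConfig V))ᶜ) ω := fun G =>
    sum_rcWeightW_ind_congr_ae w0 q fun ω hω => by
      rw [Set.mem_inter_iff, Set.mem_inter_iff, Set.mem_compl_iff, Set.mem_compl_iff, hKiff ω, mem_openConn_iff', hD0 ω hω]
  have htilt : ∀ G : Set (BondConfig V), (∀ ω : BondConfig V, ω ∆ {s(u, v)} ∈ G ↔ ω ∈ G) →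
      ∑ ω : BondConfig V, rcWeightW w0 q ∅ ω * ind G ω + (q⁻¹ - 1) * ∑ ω : BondConfig V, rcWeightW w0 q ∅ ω * ind (G ∩ Kᶜ) ω =
        ∑ ω : BondConfig V, rcWeightW w1 q ∅ ω * ind G ω := fun G hG => by
    rw [hKc G]; exact sum_tilt_eq_update_one w0 hq u v G hG
  have hWTins : ∀ ω : BondConfig V, ω ∆ {s(u, v)} ∈ Tu ∪ Tv ↔ ω ∈ Tu ∪ Tv := fun ω => by
    simp only [Set.mem_union, hTu, hTv, Set.mem_setOf_eq]
    rw [symmDiff_diff_apex_comm ω hne1 hne2]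
    simpa only [Set.mem_union] using wT_insens u v t (ω \ {s(u, x), s(x, v)})
  have hCins : ∀ ω : BondConfig V, ω ∆ {s(u, v)} ∈ Zt ∪ (Zu ∩ Tv ∪ Zv ∩ Tu) ↔ ω ∈ Zt ∪ (Zu ∩ Tv ∪ Zv ∩ Tu) := fun ω => by
    simp only [Set.mem_union, Set.mem_inter_iff, hTu, hTv, hZt, hZu, hZv, Set.mem_setOf_eq]
    rw [symmDiff_diff_apex_comm ω hne1 hne2]
    simpa only [Set.mem_union, Set.mem_inter_iff] using cZT_insens u v z t (ω \ {s(u, x), s(x, v)})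
  have eW := htilt (Tu ∪ Tv) hWTins
  have eC := htilt _ hCins
  have eWC := htilt _ (inter_insens hWTins hCins)
  have eU := htilt Set.univ (univ_insens _)
  rw [eW] at hA; rw [eC] at hB; rw [eWC] at hAB; rw [Set.univ_inter] at hZ
  have eU' : ∑ ω : BondConfig V, rcWeightW w0 q ∅ ω * ind (Set.univ : Set (BondConfig V)) ω +
      (q⁻¹ - 1) * ∑ ω : BondConfig V, rcWeightW w0 q ∅ ω * ind Kᶜ ω = rcPartitionFunctionW w1 q ∅ := by
    rw [← sum_rcWeightW_ind_univ w1 q, ← eU, Set.univ_inter]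
  rw [eU'] at hZ
  -- `w1`-masses of the plain events are the `w1`-masses of the table events
  have e1W : ∑ ω : BondConfig V, rcWeightW w1 q ∅ ω * ind (openConn u t : Set (BondConfig V)) ω =
      ∑ ω : BondConfig V, rcWeightW w1 q ∅ ω * ind (Tu ∪ Tv) ω :=
    sum_rcWeightW_ind_congr_ae w1 q fun ω hω => by
      rw [Set.mem_union, hTuiff ω, hTviff ω, hD1 ω hω, mem_openConn_iff']
      exact ⟨Or.inl, fun h => h.elim id fun h' => (hUV1 ω hω).trans h'⟩
  have e1Wv : ∑ ω : BondConfig V, rcWeightW w1 q ∅ ω * ind (openConn v t : Set (BondConfig V)) ω =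
      ∑ ω : BondConfig V, rcWeightW w1 q ∅ ω * ind (Tu ∪ Tv) ω :=
    sum_rcWeightW_ind_congr_ae w1 q fun ω hω => by
      rw [Set.mem_union, hTuiff ω, hTviff ω, hD1 ω hω, mem_openConn_iff']
      exact ⟨Or.inr, fun h => h.elim (fun h' => (hUV1 ω hω).symm.trans h') id⟩
  have e1C : ∑ ω : BondConfig V, rcWeightW w1 q ∅ ω * ind (openConn z t : Set (BondConfig V)) ω =
      ∑ ω : BondConfig V, rcWeightW w1 q ∅ ω * ind (Zt ∪ (Zu ∩ Tv ∪ Zv ∩ Tu)) ω :=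
    sum_rcWeightW_ind_congr_ae w1 q fun ω hω => by
      rw [Set.mem_union, Set.mem_union, Set.mem_inter_iff, Set.mem_inter_iff, hZtiff ω, hZuiff ω, hZviff ω, hTuiff ω, hTviff ω,
        hD1 ω hω, mem_openConn_iff']
      refine ⟨Or.inl, fun h => h.elim id fun h' => h'.elim (fun h'' => ?_) fun h'' => ?_⟩
      · exact (h''.1.trans (hUV1 ω hω)).trans h''.2
      · exact (h''.1.trans (hUV1 ω hω).symm).trans h''.2
  have e1WC : ∑ ω : BondConfig V, rcWeightW w1 q ∅ ω * ind ((openConn u t : Set (BondConfig V)) ∩ openConn z t) ω =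
      ∑ ω : BondConfig V, rcWeightW w1 q ∅ ω * ind ((Tu ∪ Tv) ∩ (Zt ∪ (Zu ∩ Tv ∪ Zv ∩ Tu))) ω :=
    sum_rcWeightW_ind_congr_ae w1 q fun ω hω => by
      rw [Set.mem_inter_iff, Set.mem_inter_iff, Set.mem_union, Set.mem_union, Set.mem_union, Set.mem_inter_iff, Set.mem_inter_iff,
        hZtiff ω, hZuiff ω, hZviff ω, hTuiff ω, hTviff ω, hD1 ω hω, mem_openConn_iff', mem_openConn_iff']
      refine ⟨fun h => ⟨Or.inl h.1, Or.inl h.2⟩, fun h => ⟨h.1.elim id fun h' => (hUV1 ω hω).trans h', ?_⟩⟩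
      exact h.2.elim id fun h' => h'.elim (fun h'' => (h''.1.trans (hUV1 ω hω)).trans h''.2)
        fun h'' => (h''.1.trans (hUV1 ω hω).symm).trans h''.2
  -- `w0`-masses of the plain events are the `w0`-masses of the preimage events
  have e0 : ∀ (a b : V) (S : Set (BondConfig V)), (∀ ω : BondConfig V, ω ∈ S ↔ (openGraph (ω \ {s(u, x), s(x, v)})).Reachable a b) →
      ∑ ω : BondConfig V, rcWeightW w0 q ∅ ω * ind (openConn a b : Set (BondConfig V)) ω =
        ∑ ω : BondConfig V, rcWeightW w0 q ∅ ω * ind S ω := fun a b S hS =>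
    sum_rcWeightW_ind_congr_ae w0 q fun ω hω => by rw [hS ω, hD0 ω hω, mem_openConn_iff']
  have e0i : ∀ (a b : V) (S S' : Set (BondConfig V)), (∀ ω : BondConfig V, ω ∈ S ↔ (openGraph (ω \ {s(u, x), s(x, v)})).Reachable a b) →
      (∀ ω : BondConfig V, ω ∈ S' ↔ (openGraph (ω \ {s(u, x), s(x, v)})).Reachable z t) →
      ∑ ω : BondConfig V, rcWeightW w0 q ∅ ω * ind ((openConn a b : Set (BondConfig V)) ∩ openConn z t) ω =
        ∑ ω : BondConfig V, rcWeightW w0 q ∅ ω * ind (S ∩ S') ω := fun a b S S' hS hS' =>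
    sum_rcWeightW_ind_congr_ae w0 q fun ω hω => by
      rw [Set.mem_inter_iff, Set.mem_inter_iff, hS ω, hS' ω, hD0 ω hω, mem_openConn_iff', mem_openConn_iff']
  -- the six hypotheses as mass inequalities
  have mHu := mass_le_of_real_mul_le w0 hq (openConn u t) (openConn z t) hHu
  rw [e0 u t Tu hTuiff, e0 z t Zt hZtiff, e0i u t Tu Zt hTuiff hZtiff, ← sum_rcWeightW_ind_univ w0 q] at mHu
  have mHv := mass_le_of_real_mul_le w0 hq (openConn v t) (openConn z t) hHv
  rw [e0 v t Tv hTviff, e0 z t Zt hZtiff, e0i v t Tv Zt hTviff hZtiff, ← sum_rcWeightW_ind_univ w0 q] at mHv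
  have mHc := mass_le_of_real_mul_le w1 hq (openConn u t) (openConn z t) hHc
  rw [e1W, e1C, e1WC] at mHc
  have mCz := mass_cross_le_of_real_le w0 w1 hq (openConn z t) hCMz
  rw [e0 z t Zt hZtiff, e1C, ← sum_rcWeightW_ind_univ w0 q] at mCz
  have mCu := mass_cross_le_of_real_le w0 w1 hq (openConn u t) hCMu
  rw [e0 u t Tu hTuiff, e1W, ← sum_rcWeightW_ind_univ w0 q] at mCu
  have mCv := mass_cross_le_of_real_le w0 w1 hq (openConn v t) hCMv
  rw [e0 v t Tv hTviff, e1Wv, ← sum_rcWeightW_ind_univ w0 q] at mCv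
  -- positivity inputs
  have hE : ∑ ω : BondConfig V, rcWeightW w0 q ∅ ω * ind (∅ : Set (BondConfig V)) ω = 0 := sum_rcWeightW_ind_empty w0 q
  rw [hE] at hA hAB
  have hM : 0 < ∑ ω : BondConfig V, rcWeightW w0 q ∅ ω * ind (Set.univ : Set (BondConfig V)) ω := by
    rw [sum_rcWeightW_ind_univ]; exact rcPartitionFunctionW_pos w0 hq (∅ : Set V)
  have hMc : 0 < rcPartitionFunctionW w1 q ∅ := rcPartitionFunctionW_pos w1 hq (∅ : Set V)
  have hcwt := sum_rcWeightW_ind_nonneg w1 hq.le (Tu ∪ Tv)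
  have ha0 : 0 ≤ ((w s(u, x) : unitInterval) : ℝ) := (w s(u, x)).2.1
  have ha1 : 0 ≤ 1 - ((w s(u, x) : unitInterval) : ℝ) := sub_nonneg.2 (w s(u, x)).2.2
  have hb0 : 0 ≤ ((w s(x, v) : unitInterval) : ℝ) := (w s(x, v)).2.1
  have hb1 : 0 ≤ 1 - ((w s(x, v) : unitInterval) : ℝ) := sub_nonneg.2 (w s(x, v)).2.2
  have hr : 0 ≤ q⁻¹ := inv_nonneg.2 hq.le
  unfold HubUnder
  apply real_mul_le_of_mass w hq
  rw [← sum_rcWeightW_ind_univ w q]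
  refine apex_rest_two_alg (n := (1 - ((w s(u, x) : unitInterval) : ℝ)) * (1 - ((w s(x, v) : unitInterval) : ℝ)))
    (U := ((w s(u, x) : unitInterval) : ℝ) * (1 - ((w s(x, v) : unitInterval) : ℝ)) * q⁻¹)
    (V := (1 - ((w s(u, x) : unitInterval) : ℝ)) * ((w s(x, v) : unitInterval) : ℝ) * q⁻¹)
    (W := ((w s(u, x) : unitInterval) : ℝ) * ((w s(x, v) : unitInterval) : ℝ) * q⁻¹)
    (by positivity) (by positivity) (by positivity) (by positivity) hM hMc hcwt
    (sub_nonneg.2 mHu) (sub_nonneg.2 mHv) (sub_nonneg.2 mHc) (by linarith [mCz]) (by linarith [mCu]) (by linarith [mCv])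
    (hA.trans (by ring)) (hB.trans (by ring)) (hAB.trans (by ring)) (hZ.trans (by ring))

end FK

end Summit.CriticalPhenomena.PercolationContinuityZ3.Theorems

end
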